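import Literature.NumberTheory.Automorphic.LocalFieldHaarNegPower     -- ★ (D3a) p852018 (F0P2-p02): `lintegral_coe_normAbs_rpow_neg_lt_top` (brings ★ `LocalFieldHaarBalls`: shells, `map_mul_left_addHaar`)
import Literature.MeasureTheory.Integral.ShellReduction               -- ★ (D3e) p852017 (F0P2-p02): `shell_reduction_le_of_image`
import HarnessLib

/-!
# `|f|^{−s}` is locally integrable for a weighted-homogeneous `f` on `Fⁿ` that is tame away from `0` (ROAD «HC-D», template of bricks (D3b)/(D3c))

Topic `NumberTheory/Automorphic`; namespace `Literature.NumberTheory.Automorphic.LocalFieldHaar`.  THEOREMS ONLY (no `def`, no instance, no notation, no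
named fact, no `sorry`); kernel lane `--kind proof --supports stmt-HodgeConjecture-24833`.  Cell `pub/hodgecm-mathlib`, crux H413 = `stmt-HodgeConjecture-24833`; ROAD
«HC-D» (LEAD F0P3a-plan T14-10; holder F0P2-p01 (g23), CENSUS-HCD v1 764fd71ae1289285 §1 (i)/(ii), §2 row D3 (b)(c)); bricks (D3b)/(D3c) F0P3b-p01 (g18) — THIS FILE is their
common TEMPLATE (census `F0/P3/F0P3b-p01/g18/hcd/CENSUS-D3bc.v1.F0P3bp01g18.md` 195c9bd2ffa5d713).  HONEST LABEL: count-neutral; HC_CM is proved only modulo the printed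
citations (hLiu418 = stmt-HodgeConjecture-24832, h413 = stmt-HodgeConjecture-24833) until rung 0 closes.

THE MATHEMATICS.  `F` a non-archimedean local field, `μ` an additive Haar measure on `F`, `μⁿ := Measure.pi μ` on `Fin n → F`, `ϖ` with `|ϖ|_F = q⁻¹`.  A COORDINATEWISE
DILATION `x ↦ (c_i x_i)_i` multiplies `μⁿ`-integrals by `∏ |c_i|⁻¹` (§1; Tate's substitution rule ★ `map_mul_left_addHaar` in each coordinate, `Measure.pi_map_pi`).  For the
WEIGHTED dilation `T x = (ϖ^{w_i} x_i)_i` (`w_i ≥ 1`, `W = Σ w_i`) and a non-negative `g` with `g ∘ T = q^{a} · g` on `𝒪ⁿ` (`a < W`; for `g = |f|^{−s}` with `f ∘ T = ϖ^D f`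
this is `a = sD`), the SHELL ARGUMENT (§2): `𝒪ⁿ = {0} ∪ ⋃_k T^k S`, `S = 𝒪ⁿ ∖ T(𝒪ⁿ)` compact with `0 ∉ S`, `∫⁻_{T^k S} g = q^{k(a−W)} ∫⁻_S g`, so `∫⁻_{𝒪ⁿ} g ≤ (1 − q^{a−W})⁻¹ ∫⁻_S g`,
and `∫⁻_S g < ∞` as soon as every point of `S` (all `≠ 0`) has a neighbourhood of finite integral (§3, compactness).  HEAD (§4) `exists_nhds_lintegral_lt_top_of_homogeneous`:
local finiteness at every `y ≠ 0` + weighted homogeneity with `a < W` ⇒ local finiteness at EVERY `y` (the `L¹_loc` statement in the «`∀ y, ∃ U ∈ 𝓝 y, ∫⁻_U g < ∞`» form the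
HC-D consumers read).  The two instances — (D3b) `|Q|^{−1/2}`, `Q` a non-degenerate ternary quadratic form (`D = 2`, `w = (1,1,1)`), and (D3c) the plane cusp `|−4a³−27db²|^{−1/2}`
(`D = 6`, `w = (2,3)`) — supply the local finiteness at `y ≠ 0` from the submersion bricks (★ D1/D2, ★ (D2-lin), (D3a)) in their own files.

## References
* [HarishChandra1970] Harish-Chandra, *Harmonic analysis on reductive p-adic groups*, LNM 162 (1970), Part VII §1 (local integrability of `|D|^{−1/2}`; here only the model singularities).
* [Tate1950] J. Tate, *Fourier analysis in number fields and Hecke's zeta-functions* (1950), §2.2 Lemma 2.2.5 (`dμ(αξ) = |α| dμ(ξ)`).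
* [WeilBNT1967] A. Weil, *Basic Number Theory* (1967), Ch. I §2 (Haar measure and the module of an automorphism, `mod(a) = |a|`), Ch. I §4 (balls `𝔭ⁿ`), Ch. II §1 (modules on vector spaces: `mod_V` of a diagonal map is the product of the `|a_i|`).
-/

set_option autoImplicit false

noncomputable section

open MeasureTheory MeasureTheory.Measure ValuativeRel Filter Topology Set
open scoped NNReal ENNReal Pointwise
open Literature.NumberTheory.GaloisRepresentations.IsNonarchimedeanLocalField

namespace Literature.NumberTheory.Automorphic

namespace LocalFieldHaar

variable {F : Type*} [Field F] [ValuativeRel F] [TopologicalSpace F] [IsNonarchimedeanLocalField F]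
  [MeasurableSpace F] [BorelSpace F] (μ : Measure F) [μ.IsAddHaarMeasure] {n : ℕ}

/-! ## §1 Coordinatewise dilations of `Measure.pi μ` -/

omit [Field F] [ValuativeRel F] [TopologicalSpace F] [IsNonarchimedeanLocalField F] [BorelSpace F] [μ.IsAddHaarMeasure] in
/-- `Measure.pi (r • μ_i) = (∏ r_i) • Measure.pi μ` (`ℝ≥0` scalars; both sides agree on boxes). [cite: WeilBNT1967, Ch. II §1 (product Haar measures)] -/
theorem pi_nnreal_smul [SigmaFinite μ] (r : Fin n → ℝ≥0) :
    Measure.pi (fun i : Fin n => r i • μ) = (∏ i, r i) • Measure.pi (fun _ : Fin n => μ) := by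
  refine Measure.pi_eq fun s _ => ?_
  simp only [Measure.smul_apply, Measure.pi_pi, ENNReal.smul_def, smul_eq_mul, ENNReal.ofNNReal_finsetProd, Finset.prod_mul_distrib]

/-- **Substitution rule for a coordinatewise dilation**: `∫⁻ g((c_i x_i)_i) dμⁿ(x) = (∏ |c_i|⁻¹) · ∫⁻ g dμⁿ` for `c_i ≠ 0` (the module of the diagonal automorphism
`diag(c)` of `Fⁿ` is `∏ |c_i|`). [cite: Tate1950, §2.2 Lemma 2.2.5] [cite: WeilBNT1967, Ch. II §1 Prop. 2 (module of an automorphism of a vector space)] -/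
theorem lintegral_comp_dilation (c : Fin n → F) (hc : ∀ i, c i ≠ 0) (g : (Fin n → F) → ℝ≥0∞) :
    ∫⁻ x, g (fun i => c i * x i) ∂(Measure.pi fun _ : Fin n => μ) =
      ((∏ i, (normAbs F (c i))⁻¹ : ℝ≥0) : ℝ≥0∞) * ∫⁻ x, g x ∂(Measure.pi fun _ : Fin n => μ) := by
  haveI := sigmaCompactSpace_of_isNonarchimedeanLocalField F
  have hmi : ∀ i : Fin n, μ.map (fun x => c i * x) = (normAbs F (c i))⁻¹ • μ := fun i => by
    rw [map_mul_left_addHaar μ (hc i), map_inv₀]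
    ext s hs
    simp only [Measure.smul_apply, ENNReal.smul_def, smul_eq_mul]
  haveI : ∀ i : Fin n, SigmaFinite (μ.map (fun x => c i * x)) := fun i => by rw [hmi i]; infer_instance
  have hmap : (Measure.pi fun _ : Fin n => μ).map (fun (x : Fin n → F) (i : Fin n) => c i * x i) =
      Measure.pi fun i : Fin n => (normAbs F (c i))⁻¹ • μ := by
    rw [Measure.pi_map_pi (fun i => (measurable_const_mul (c i)).aemeasurable)]
    exact congrArg _ (funext hmi)
  let e : (Fin n → F) ≃ᵐ (Fin n → F) := MeasurableEquiv.piCongrRight fun i => MeasurableEquiv.mulLeft₀ (c i) (hc i)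
  have h1 : ∫⁻ x, g (fun i => c i * x i) ∂(Measure.pi fun _ : Fin n => μ) =
      ∫⁻ y, g y ∂((Measure.pi fun _ : Fin n => μ).map (fun (x : Fin n → F) (i : Fin n) => c i * x i)) :=
    (lintegral_map_equiv g e).symm
  rw [h1, hmap, pi_nnreal_smul, lintegral_smul_measure, ENNReal.smul_def, smul_eq_mul]

/-! ## §2 The weighted dilation `T x = (ϖ^{w i} x_i)_i`: iterates, the balls `T^k(𝒪ⁿ)`, the core `⋂_k T^k(𝒪ⁿ) = {0}` -/

omit [MeasurableSpace F] [BorelSpace F] [μ.IsAddHaarMeasure] [IsNonarchimedeanLocalField F] [ValuativeRel F] [TopologicalSpace F] in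
/-- Iterating the weighted dilation multiplies the exponents: `T^k x = (ϖ^{k·w i} x_i)_i`. [folklore] -/
private theorem iterate_dilation (ϖ : F) (w : Fin n → ℕ) (k : ℕ) :
    (fun (x : Fin n → F) (i : Fin n) => ϖ ^ (w i) * x i)^[k] = fun (x : Fin n → F) (i : Fin n) => ϖ ^ (k * w i) * x i := by
  induction k with
  | zero => funext x i; simp
  | succ k ih =>
    rw [Function.iterate_succ', ih]
    funext x i
    simp only [Function.comp_apply, Nat.succ_mul, pow_add]
    ring

omit [MeasurableSpace F] [BorelSpace F] [μ.IsAddHaarMeasure] in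
/-- Membership in `T^k(𝒪ⁿ)`: `x ∈ T^k '' 𝒪ⁿ ↔ ∀ i, |x_i| ≤ q^{−k·w_i}` (the balls `𝔭^{k w_i}`). [cite: WeilBNT1967, Ch. I §4 (the ideals `𝔭ⁿ` as balls)] -/
theorem mem_image_iterate_dilation_iff {ϖ : F} (hϖ : normAbs F ϖ = ((residueFieldCard F : ℝ≥0))⁻¹) (w : Fin n → ℕ) (k : ℕ)
    (x : Fin n → F) :
    x ∈ (fun (x : Fin n → F) (i : Fin n) => ϖ ^ (w i) * x i)^[k] '' (Set.pi Set.univ fun _ : Fin n => primePowBall F 0) ↔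
      ∀ i, normAbs F (x i) ≤ (((residueFieldCard F : ℝ≥0))⁻¹) ^ (k * w i) := by
  have hϖ0 : ϖ ≠ 0 := fun h => by
    rw [h, map_zero] at hϖ
    exact (ne_of_gt (inv_residueFieldCard_pos (F := F))) hϖ.symm
  rw [iterate_dilation]
  constructor
  · rintro ⟨y, hy, rfl⟩ i
    have hyi : normAbs F (y i) ≤ 1 := by
      have := hy i (Set.mem_univ i)
      simpa [primePowBall] using this
    calc normAbs F (ϖ ^ (k * w i) * y i) = (((residueFieldCard F : ℝ≥0))⁻¹) ^ (k * w i) * normAbs F (y i) := by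
          rw [map_mul, map_pow, hϖ]
      _ ≤ (((residueFieldCard F : ℝ≥0))⁻¹) ^ (k * w i) * 1 := by gcongr
      _ = _ := mul_one _
  · intro hx
    refine ⟨fun i => (ϖ ^ (k * w i))⁻¹ * x i, fun i _ => ?_, funext fun i => by beta_reduce; rw [← mul_assoc, mul_inv_cancel₀ (pow_ne_zero _ hϖ0), one_mul]⟩
    show (ϖ ^ (k * w i))⁻¹ * x i ∈ primePowBall F 0
    simp only [primePowBall, zpow_zero, Set.mem_setOf_eq, map_mul, map_inv₀, map_pow, hϖ, inv_pow, inv_inv]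
    have hq : (0 : ℝ≥0) < (residueFieldCard F : ℝ≥0) ^ (k * w i) :=
      pow_pos (by exact_mod_cast zero_lt_one.trans (one_lt_residueFieldCard F)) _
    calc (residueFieldCard F : ℝ≥0) ^ (k * w i) * normAbs F (x i)
        ≤ (residueFieldCard F : ℝ≥0) ^ (k * w i) * (((residueFieldCard F : ℝ≥0))⁻¹) ^ (k * w i) := by gcongr; exact hx i
      _ = 1 := by rw [inv_pow, mul_inv_cancel₀ hq.ne']

omit [MeasurableSpace F] [BorelSpace F] [μ.IsAddHaarMeasure] in
/-- **The core of the shells is the origin**: `⋂_k T^k(𝒪ⁿ) = {0}` when every weight is `≥ 1` (`⋂_n 𝔭ⁿ = 0`). [cite: WeilBNT1967, Ch. I §4 (the `𝔭ⁿ` form a fundamental system of neighbourhoods of `0`)] -/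
theorem iInter_image_iterate_dilation_eq {ϖ : F} (hϖ : normAbs F ϖ = ((residueFieldCard F : ℝ≥0))⁻¹) {w : Fin n → ℕ} (hw : ∀ i, 1 ≤ w i) :
    (⋂ k : ℕ, (fun (x : Fin n → F) (i : Fin n) => ϖ ^ (w i) * x i)^[k] '' (Set.pi Set.univ fun _ : Fin n => primePowBall F 0)) = {0} := by
  ext x
  simp only [Set.mem_iInter, mem_image_iterate_dilation_iff hϖ, Set.mem_singleton_iff]
  constructor
  · intro h
    funext i
    by_contra hxi
    have hpos : 0 < normAbs F (x i) := pos_iff_ne_zero.2 ((map_ne_zero (normAbs F)).2 hxi)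
    -- `(q⁻¹)^(k w_i) ≤ (q⁻¹)^k → 0`: pick `k` with `(q⁻¹)^k < |x i|`
    obtain ⟨k, hk⟩ := exists_pow_lt_of_lt_one hpos (inv_residueFieldCard_lt_one (F := F))
    have h1 : (((residueFieldCard F : ℝ≥0))⁻¹) ^ (k * w i) ≤ (((residueFieldCard F : ℝ≥0))⁻¹) ^ k :=
      pow_le_pow_of_le_one (le_of_lt (inv_residueFieldCard_pos (F := F))) (inv_residueFieldCard_lt_one (F := F)).le (Nat.le_mul_of_pos_right k (hw i))
    exact absurd ((h k i).trans h1) (not_le.2 hk)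
  · rintro rfl k i
    simp

/-! ## §3 Local finiteness on a compact set from local finiteness at its points -/

omit [Field F] [ValuativeRel F] [TopologicalSpace F] [IsNonarchimedeanLocalField F] [MeasurableSpace F] [BorelSpace F] [μ.IsAddHaarMeasure] in
/-- **Compactness**: if every point of a compact `K` has a neighbourhood of finite `∫⁻ g`, then `∫⁻_K g < ∞` (any measure space with a topology; the local-to-compact
step of «locally integrable ⇒ integrable on compacts»). [cite: DeitmarEchterhoff2014, §1.3 (Radon measures: local finiteness on compacta)] -/
theorem setLIntegral_lt_top_of_isCompact_of_nhds {X : Type*} [TopologicalSpace X] [MeasurableSpace X] (ν : Measure X) (g : X → ℝ≥0∞)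
    {K : Set X} (hK : IsCompact K) (h : ∀ y ∈ K, ∃ U ∈ 𝓝 y, ∫⁻ x in U, g x ∂ν < ∞) : ∫⁻ x in K, g x ∂ν < ∞ := by
  refine hK.induction_on (p := fun A => ∫⁻ x in A, g x ∂ν < ∞) (by simp) (fun s t hst ht => (lintegral_mono_set hst).trans_lt ht)
    (fun s t hs ht => (lintegral_union_le _ s t).trans_lt (ENNReal.add_lt_top.2 ⟨hs, ht⟩)) fun y hy => ?_
  obtain ⟨U, hU, hfin⟩ := h y hy
  exact ⟨U, mem_nhdsWithin_of_mem_nhds hU, hfin⟩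

/-! ## §4 THE TEMPLATE HEAD -/

/-- **`|f|^{−s}`-TYPE FUNCTIONS HOMOGENEOUS UNDER A WEIGHTED DILATION ARE LOCALLY INTEGRABLE ONCE THEY ARE SO AWAY FROM `0`.**  Let `g : Fⁿ → [0,∞]` satisfy
`g (T x) = κ · g x` for the weighted dilation `T x = (ϖ^{w i} x_i)_i` (`|ϖ| = q⁻¹`, weights `w i ≥ 1`, `W = Σ w i`) with `κ < q^W` (for `g = |f|^{−s}`, `f ∘ T = ϖ^D · f`:
`κ = q^{sD}`, i.e. `s·D < W`), and suppose every `y ≠ 0` has a neighbourhood `U` with `∫⁻_U g dμⁿ < ∞` (`μⁿ = Measure.pi μ`, `μ` additive Haar on `F`).  Then EVERY `y`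
has such a neighbourhood — at `0` the ball `𝒪ⁿ`: its shell `𝒪ⁿ ∖ T(𝒪ⁿ)` is compact and misses `0` (§3 ⇒ finite), `∫⁻_{T A} g = q^{−W} κ · ∫⁻_A g` (§1), `⋂_k T^k(𝒪ⁿ) = {0}` is
`μⁿ`-null (§2), so ★ (D3e) `shell_reduction_le_of_image` bounds `∫⁻_{𝒪ⁿ} g` by `(1 − q^{−W}κ)⁻¹ ∫⁻_{shell} g < ∞`.
[cite: HarishChandra1970, Part VII §1 Thm. 15 (the model singularities of `|D|^{−1/2}`)] [cite: WeilBNT1967, Ch. I §2, Ch. II §1 (modules of dilations)] -/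
theorem exists_nhds_setLIntegral_lt_top_of_dilation {ϖ : F} (hϖ : normAbs F ϖ = ((residueFieldCard F : ℝ≥0))⁻¹) {w : Fin n → ℕ}
    (hw : ∀ i, 1 ≤ w i) (hn : n ≠ 0) (g : (Fin n → F) → ℝ≥0∞) (hgm : Measurable g) {κ : ℝ≥0∞}
    (hg : ∀ x, g (fun i => ϖ ^ (w i) * x i) = κ * g x)
    (hκ : κ < (residueFieldCard F : ℝ≥0∞) ^ (∑ i, w i))
    (hloc : ∀ y : Fin n → F, y ≠ 0 → ∃ U ∈ 𝓝 y, ∫⁻ x in U, g x ∂(Measure.pi fun _ : Fin n => μ) < ∞) :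
    ∀ y : Fin n → F, ∃ U ∈ 𝓝 y, ∫⁻ x in U, g x ∂(Measure.pi fun _ : Fin n => μ) < ∞ := by
  intro y
  by_cases hy : y ≠ 0
  · exact hloc y hy
  rw [not_ne_iff] at hy
  subst hy
  haveI := sigmaCompactSpace_of_isNonarchimedeanLocalField F
  haveI := secondCountableTopology_localField F
  have hϖ0 : ϖ ≠ 0 := fun h => by
    rw [h, map_zero] at hϖ
    exact (ne_of_gt (inv_residueFieldCard_pos (F := F))) hϖ.symm
  -- `T` is a measurable equivalence: images of measurable sets are measurable, `T` is injective
  let e : (Fin n → F) ≃ᵐ (Fin n → F) := MeasurableEquiv.piCongrRight fun i => MeasurableEquiv.mulLeft₀ (ϖ ^ (w i)) (pow_ne_zero _ hϖ0)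
  have he : ⇑e = (fun (x : Fin n → F) (i : Fin n) => ϖ ^ (w i) * x i) := rfl
  have hTm : ∀ A : Set (Fin n → F), MeasurableSet A → MeasurableSet ((fun (x : Fin n → F) (i : Fin n) => ϖ ^ (w i) * x i) '' A) := fun A hA => by
    rw [← he]; exact e.measurableSet_image.2 hA
  have hinj : Function.Injective (fun (x : Fin n → F) (i : Fin n) => ϖ ^ (w i) * x i) := he ▸ e.injective
  have hW₀m : MeasurableSet (Set.pi Set.univ fun _ : Fin n => primePowBall F 0) := MeasurableSet.univ_pi fun _ => measurableSet_primePowBall 0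
  -- `T(𝒪ⁿ) = Π 𝔭^(w i) ⊆ 𝒪ⁿ` is open; `𝒪ⁿ` is compact open and contains `0`
  have hTW₀ : (fun (x : Fin n → F) (i : Fin n) => ϖ ^ (w i) * x i) '' (Set.pi Set.univ fun _ : Fin n => primePowBall F 0) = Set.pi Set.univ fun i : Fin n => primePowBall F (w i) := by
    ext x
    have h1 := mem_image_iterate_dilation_iff (n := n) hϖ w 1 x
    simp only [Function.iterate_one, one_mul] at h1
    rw [h1, Set.mem_univ_pi]
    simp only [primePowBall, Set.mem_setOf_eq, zpow_natCast]
  have hsub : (fun (x : Fin n → F) (i : Fin n) => ϖ ^ (w i) * x i) '' (Set.pi Set.univ fun _ : Fin n => primePowBall F 0) ⊆ (Set.pi Set.univ fun _ : Fin n => primePowBall F 0) := by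
    rw [hTW₀]
    refine Set.pi_mono fun i _ x hx => ?_
    simp only [primePowBall, Set.mem_setOf_eq, zpow_zero, zpow_natCast] at hx ⊢
    exact hx.trans (pow_le_one₀ (le_of_lt inv_residueFieldCard_pos) inv_residueFieldCard_lt_one.le)
  have hW₀c : IsCompact (Set.pi Set.univ fun _ : Fin n => primePowBall F 0) := isCompact_univ_pi fun _ => isCompact_primePowBall 0
  have hTW₀o : IsOpen ((fun (x : Fin n → F) (i : Fin n) => ϖ ^ (w i) * x i) '' (Set.pi Set.univ fun _ : Fin n => primePowBall F 0)) := by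
    rw [hTW₀]; exact isOpen_set_pi Set.finite_univ fun i _ => isOpen_primePowBall _
  have hW₀o : IsOpen (Set.pi Set.univ fun _ : Fin n => primePowBall F 0) := isOpen_set_pi Set.finite_univ fun _ _ => isOpen_primePowBall 0
  have h0W₀ : (0 : Fin n → F) ∈ (Set.pi Set.univ fun _ : Fin n => primePowBall F 0) := fun i _ => by simp [primePowBall]
  -- the shell is compact and misses `0`, hence carries a finite integral (§3 + `hloc`)
  have hSc : IsCompact ((Set.pi Set.univ fun _ : Fin n => primePowBall F 0) \ (fun (x : Fin n → F) (i : Fin n) => ϖ ^ (w i) * x i) '' (Set.pi Set.univ fun _ : Fin n => primePowBall F 0)) := hW₀c.diff hTW₀o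
  have h0S : (0 : Fin n → F) ∉ (Set.pi Set.univ fun _ : Fin n => primePowBall F 0) \ (fun (x : Fin n → F) (i : Fin n) => ϖ ^ (w i) * x i) '' (Set.pi Set.univ fun _ : Fin n => primePowBall F 0) := fun h => h.2 ⟨0, h0W₀, funext fun i => by simp⟩
  have hSfin : ∫⁻ x in (Set.pi Set.univ fun _ : Fin n => primePowBall F 0) \ (fun (x : Fin n → F) (i : Fin n) => ϖ ^ (w i) * x i) '' (Set.pi Set.univ fun _ : Fin n => primePowBall F 0), g x ∂(Measure.pi fun _ : Fin n => μ) < ∞ :=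
    setLIntegral_lt_top_of_isCompact_of_nhds _ g hSc fun y hy => hloc y (fun h => h0S (h ▸ hy))
  -- the Jacobian `P = ∏ |ϖ^(w i)|⁻¹ = q^W` and the contraction ratio `θ = P⁻¹ κ < 1`
  have hP : ((∏ i, (normAbs F (ϖ ^ (w i)))⁻¹ : ℝ≥0) : ℝ≥0∞) = (residueFieldCard F : ℝ≥0∞) ^ (∑ i, w i) := by
    simp only [map_pow, hϖ, inv_pow, inv_inv, Finset.prod_pow_eq_pow_sum, ENNReal.coe_pow, ENNReal.coe_natCast]
  have hP0 : ((∏ i, (normAbs F (ϖ ^ (w i)))⁻¹ : ℝ≥0) : ℝ≥0∞) ≠ 0 := by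
    rw [hP]; exact pow_ne_zero _ (by exact_mod_cast (zero_lt_one.trans (one_lt_residueFieldCard F)).ne')
  have hPt : ((∏ i, (normAbs F (ϖ ^ (w i)))⁻¹ : ℝ≥0) : ℝ≥0∞) ≠ ⊤ := ENNReal.coe_ne_top
  have hθ1 : ((∏ i, (normAbs F (ϖ ^ (w i)))⁻¹ : ℝ≥0) : ℝ≥0∞)⁻¹ * κ < 1 := by
    have h1 : κ / ((∏ i, (normAbs F (ϖ ^ (w i)))⁻¹ : ℝ≥0) : ℝ≥0∞) < 1 := by
      rw [ENNReal.div_lt_iff (Or.inl hP0) (Or.inl hPt), one_mul, hP]; exact hκ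
    rwa [div_eq_mul_inv, mul_comm] at h1
  -- contraction `∫⁻_(T A) g = P⁻¹ κ ∫⁻_A g` (§1)
  have hcontract : ∀ A ⊆ (Set.pi Set.univ fun _ : Fin n => primePowBall F 0), MeasurableSet A →
      ∫⁻ x in (fun (x : Fin n → F) (i : Fin n) => ϖ ^ (w i) * x i) '' A, g x ∂(Measure.pi fun _ : Fin n => μ) ≤ (((∏ i, (normAbs F (ϖ ^ (w i)))⁻¹ : ℝ≥0) : ℝ≥0∞)⁻¹ * κ) * ∫⁻ x in A, g x ∂(Measure.pi fun _ : Fin n => μ) := by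
    intro A _ hA
    have h2 : ∫⁻ x, ((fun (x : Fin n → F) (i : Fin n) => ϖ ^ (w i) * x i) '' A).indicator g ((fun (x : Fin n → F) (i : Fin n) => ϖ ^ (w i) * x i) x) ∂(Measure.pi fun _ : Fin n => μ) = ((∏ i, (normAbs F (ϖ ^ (w i)))⁻¹ : ℝ≥0) : ℝ≥0∞) * ∫⁻ x, ((fun (x : Fin n → F) (i : Fin n) => ϖ ^ (w i) * x i) '' A).indicator g x ∂(Measure.pi fun _ : Fin n => μ) :=
      lintegral_comp_dilation μ (fun i => ϖ ^ (w i)) (fun i => pow_ne_zero _ hϖ0) _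
    have h3 : ∀ x, ((fun (x : Fin n → F) (i : Fin n) => ϖ ^ (w i) * x i) '' A).indicator g ((fun (x : Fin n → F) (i : Fin n) => ϖ ^ (w i) * x i) x) = A.indicator (fun x => κ * g x) x := fun x => by
      rw [Set.indicator_image hinj, Function.comp_def]
      by_cases hx : x ∈ A
      · rw [Set.indicator_of_mem hx, Set.indicator_of_mem hx, hg]
      · rw [Set.indicator_of_notMem hx, Set.indicator_of_notMem hx]
    have h4 : ∫⁻ x, ((fun (x : Fin n → F) (i : Fin n) => ϖ ^ (w i) * x i) '' A).indicator g x ∂(Measure.pi fun _ : Fin n => μ) = ((∏ i, (normAbs F (ϖ ^ (w i)))⁻¹ : ℝ≥0) : ℝ≥0∞)⁻¹ * ∫⁻ x, ((fun (x : Fin n → F) (i : Fin n) => ϖ ^ (w i) * x i) '' A).indicator g ((fun (x : Fin n → F) (i : Fin n) => ϖ ^ (w i) * x i) x) ∂(Measure.pi fun _ : Fin n => μ) := by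
      rw [h2, ← mul_assoc, ENNReal.inv_mul_cancel hP0 hPt, one_mul]
    rw [← lintegral_indicator (hTm A hA), h4]
    simp only [h3]
    rw [lintegral_indicator hA, lintegral_const_mul _ hgm, ← mul_assoc]
  -- the core `⋂_k T^k(𝒪ⁿ) = {0}` is null
  have hcore : ∫⁻ x in ⋂ k, (fun (x : Fin n → F) (i : Fin n) => ϖ ^ (w i) * x i)^[k] '' (Set.pi Set.univ fun _ : Fin n => primePowBall F 0), g x ∂(Measure.pi fun _ : Fin n => μ) = 0 := by
    rw [iInter_image_iterate_dilation_eq hϖ hw]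
    exact setLIntegral_measure_zero _ _ (by rw [Measure.pi_singleton]; simp [measure_singleton_zero μ, hn])
  -- ★ (D3e) shell reduction
  have hle := Literature.MeasureTheory.Integral.shell_reduction_le_of_image (Measure.pi fun _ : Fin n => μ) g (fun (x : Fin n → F) (i : Fin n) => ϖ ^ (w i) * x i) hTm (Set.pi Set.univ fun _ : Fin n => primePowBall F 0) hW₀m hsub (((∏ i, (normAbs F (ϖ ^ (w i)))⁻¹ : ℝ≥0) : ℝ≥0∞)⁻¹ * κ) hcontract hcore
  refine ⟨(Set.pi Set.univ fun _ : Fin n => primePowBall F 0), hW₀o.mem_nhds h0W₀, hle.trans_lt ?_⟩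
  exact ENNReal.mul_lt_top (ENNReal.inv_lt_top.2 (tsub_pos_of_lt hθ1)) hSfin

end LocalFieldHaar

end Literature.NumberTheory.Automorphic

end
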